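import Mathlib
import Summits.KontsevichZagierPeriods.Zeta5Search.LeadingDigitSeries
import Summits.KontsevichZagierPeriods.Zeta5Search.UniversalDigit
import Summits.KontsevichZagierPeriods.Zeta5Search.ConstantTermFloorWindow
import HarnessLib

/-!
# ζ(5) search — the PALINDROME LEMMA: `ŵ_x = 0` for a palindromic class with `3 + E_x` odd

Cell `pub-zeta5` (HONEST FRAMING: systematic search; no irrationality claim unless certified), typer seat
generation 9.  Gen-2 g6's palindrome lemma (REPORT-gen2-g6 §4a, "`Ψ_s(Φ_x) = 0` when `Φ_x(L−η) = ±Φ_x(η)` and `s + E_x` is odd",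
the source of the `+1` PALINDROME BONUS in `classBound`, `ClusterValuation` §2) for `s = 3`, as an identity of the class
cofactors (`classCofactor`, `classRho`) and of gen-2 g9's type invariant `ŵ_x = Σ_{poles of order ≥ 3} ρ_{q,3}` (`wHat`,
`Zeta5Search/UniversalDigit.lean`):

* `binomSeries_neg_base`: `binomSeries (−δ) e = (−1)^e · (binomSeries δ e)(−X)`;
* `classCofactor_invol`, `classRho_invol`: under a level-reversing involution `τ` of the non-neutral class points preserving the net
  exponents (and, for a self-conjugate class with odd `b₀`, reversing about the centre), `Φ`-data transform by
  `ρ_{τq,σ} = (−1)^{E_x+σ} ρ_{q,σ}`;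
* `wHat_eq_zero_of_invol`, and the two sources of such involutions: the conjugation `s ↦ b₀ − s` of a self-conjugate class and
  the reflection of a palindromic configuration (`IsPalindromic (classConfig b p x)`) — **`wHat_eq_zero_of_palindromic`**.
Pure algebra of formal power series over `ℚ`; nothing about irrationality.
-/

noncomputable section

open Finset PowerSeries

namespace Summit.KontsevichZagierPeriods.Zeta5Search.ClusterValuation

open Summit.KontsevichZagierPeriods.Zeta5Search.DualSeries (InBox)
open Summit.KontsevichZagierPeriods.Zeta5Search.CasoratianValuation (InPolytope)

/-! ### `binomSeries` at `−δ` -/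

/-- `(−1)^{e−j} = (−1)^e (−1)^j`. -/
theorem neg_one_zpow_sub_natCast (e : ℤ) (j : ℕ) : (-1 : ℚ) ^ (e - j) = (-1) ^ e * (-1) ^ j := by
  have h1 : ((-1 : ℚ) ^ j) * (-1) ^ j = 1 := by rw [← pow_add, ← two_mul, pow_mul]; norm_num
  rw [zpow_sub₀ (by norm_num : (-1 : ℚ) ≠ 0), zpow_natCast, div_eq_mul_inv, inv_eq_of_mul_eq_one_right h1]

/-- **`binomSeries (−δ) e = (−1)^e · rescale (−1) (binomSeries δ e)`.** -/
theorem binomSeries_neg_base (δ : ℚ) (e : ℤ) :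
    binomSeries (-δ) e = C ((-1 : ℚ) ^ e) * rescale (-1) (binomSeries δ e) := by
  ext j
  rw [coeff_binomSeries, coeff_C_mul, coeff_rescale, coeff_binomSeries, neg_eq_neg_one_mul δ, mul_zpow,
    neg_one_zpow_sub_natCast]
  ring

/-- `(−1)^{a + 2c} = (−1)^a`. -/
theorem neg_one_zpow_add_two_mul (a c : ℤ) : (-1 : ℚ) ^ (a + 2 * c) = (-1) ^ a := by
  rw [zpow_add₀ (by norm_num : (-1 : ℚ) ≠ 0), zpow_mul]; norm_num

/-! ### The class cofactor under a level-reversing involution -/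

section Invol

variable (b : ℕ → ℤ) {p x : ℕ} (τ : ℕ → ℕ)
  (hD : ∀ s ∈ (classSet b p x).filter (fun s => netExp b s ≠ 0), τ s ∈ (classSet b p x).filter (fun s => netExp b s ≠ 0))
  (hinv : ∀ s ∈ (classSet b p x).filter (fun s => netExp b s ≠ 0), τ (τ s) = s)
  (he : ∀ s ∈ (classSet b p x).filter (fun s => netExp b s ≠ 0), netExp b (τ s) = netExp b s)
  (hlin : ∀ s ∈ (classSet b p x).filter (fun s => netExp b s ≠ 0), ∀ t ∈ (classSet b p x).filter (fun s => netExp b s ≠ 0),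
    ((τ s : ℚ) - τ t) = -((s : ℚ) - t))
  (hcen : (¬ (2 : ℤ) ∣ b 0 ∧ CentreIn b p x) → ∀ s ∈ (classSet b p x).filter (fun s => netExp b s ≠ 0),
    (τ s : ℚ) - (b 0 : ℚ) / 2 = -((s : ℚ) - (b 0 : ℚ) / 2))

/-- The cofactor product may be restricted to the non-neutral class points (neutral factors are `1`). -/
theorem cofactor_prod_restrict {q : ℕ} (hq : q ∈ classSet b p x) :
    ∏ s ∈ (classSet b p q).erase q, binomSeries (((q : ℚ) - s) / p) (netExp b s) =
      ∏ s ∈ ((classSet b p x).filter (fun s => netExp b s ≠ 0)).erase q, binomSeries (((q : ℚ) - s) / p) (netExp b s) := by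
  rw [classSet_eq_of_mem hq]
  symm
  refine prod_subset (fun s hs => mem_erase.2 ⟨(mem_erase.1 hs).1, (mem_filter.1 (mem_erase.1 hs).2).1⟩) ?_
  intro s hs hns
  have hs' := mem_erase.1 hs
  have h0 : netExp b s = 0 := by
    by_contra hne
    exact hns (mem_erase.2 ⟨hs'.1, mem_filter.2 ⟨hs'.2, hne⟩⟩)
  rw [h0, binomSeries_zero]

include hD hinv he hlin hcen in
/-- **The cofactor at the reflected pole**: `Φ`-cofactor(τ q) = (−1)^{E_x − e_q} · (Φ-cofactor(q))(−X)`. -/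
theorem classCofactor_invol {q : ℕ} (hq : q ∈ (classSet b p x).filter (fun s => netExp b s ≠ 0)) (hqn : q ≤ (b 0).toNat) :
    classCofactor b p (τ q) = C ((-1 : ℚ) ^ (classExp b p x - netExp b q)) * rescale (-1) (classCofactor b p q) := by
  set D := (classSet b p x).filter (fun s => netExp b s ≠ 0) with hDdef
  have hqC : q ∈ classSet b p x := (mem_filter.1 hq).1
  have hτq : τ q ∈ D := hD q hq
  have hτqC : τ q ∈ classSet b p x := (mem_filter.1 hτq).1
  have hm1 : (-1 : ℚ) ≠ 0 := by norm_num
  -- the products over the non-neutral points, reindexed by `τ`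
  have hprod : ∏ s ∈ D.erase (τ q), binomSeries (((τ q : ℚ) - s) / p) (netExp b s) =
      ∏ s ∈ D.erase q, binomSeries (((τ q : ℚ) - τ s) / p) (netExp b (τ s)) := by
    symm
    refine prod_nbij' τ τ (fun s hs => ?_) (fun s hs => ?_) (fun s hs => hinv s (mem_of_mem_erase hs))
      (fun s hs => hinv s (mem_of_mem_erase hs)) (fun s hs => rfl)
    · have hs' := mem_erase.1 hs
      refine mem_erase.2 ⟨fun h => hs'.1 ?_, hD s hs'.2⟩
      rw [← hinv s hs'.2, h, hinv q hq]
    · have hs' := mem_erase.1 hs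
      refine mem_erase.2 ⟨fun h => hs'.1 ?_, hD s hs'.2⟩
      rw [← hinv s hs'.2, h]
  have hprod2 : ∏ s ∈ D.erase q, binomSeries (((τ q : ℚ) - τ s) / p) (netExp b (τ s)) =
      C ((-1 : ℚ) ^ (∑ s ∈ D.erase q, netExp b s)) *
        rescale (-1) (∏ s ∈ D.erase q, binomSeries (((q : ℚ) - s) / p) (netExp b s)) := by
    rw [map_prod, ← prod_zpow_eq _ _ hm1, map_prod, ← prod_mul_distrib]
    refine prod_congr rfl fun s hs => ?_
    have hs' := mem_of_mem_erase hs
    rw [he s hs', hlin q hq s hs', show -((q : ℚ) - s) / p = -(((q : ℚ) - s) / p) by ring, binomSeries_neg_base]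
  -- the exponent sum
  have hsumD : ∑ s ∈ D.erase q, netExp b s = ∑ s ∈ (classSet b p q).erase q, netExp b s := by
    rw [classSet_eq_of_mem hqC]
    refine sum_subset (fun s hs => mem_erase.2 ⟨(mem_erase.1 hs).1, (mem_filter.1 (mem_erase.1 hs).2).1⟩) ?_
    intro s hs hns
    have hs' := mem_erase.1 hs
    by_contra hne
    exact hns (mem_erase.2 ⟨hs'.1, mem_filter.2 ⟨hs'.2, hne⟩⟩)
  have hnear := nearExp_eq b (p := p) hqn
  rw [classExp_eq_of_mem hqC] at hnear
  -- the centre conditions agree along the class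
  have hcq : CentreIn b p q ↔ CentreIn b p x := centreIn_iff_of_mem hqC
  have hcτ : CentreIn b p (τ q) ↔ CentreIn b p x := centreIn_iff_of_mem hτqC
  -- assemble
  unfold classCofactor
  rw [cofactor_prod_restrict b hτqC, cofactor_prod_restrict b hqC, ← hDdef, hprod, hprod2]
  by_cases hc : ¬ (2 : ℤ) ∣ b 0 ∧ CentreIn b p x
  · have hc1 : ¬ (2 : ℤ) ∣ b 0 ∧ CentreIn b p q := ⟨hc.1, hcq.2 hc.2⟩
    have hc2 : ¬ (2 : ℤ) ∣ b 0 ∧ CentreIn b p (τ q) := ⟨hc.1, hcτ.2 hc.2⟩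
    rw [if_pos hc1, if_pos hc2]
    rw [if_pos hc1] at hnear
    have hδ : ((τ q : ℚ) - (b 0 : ℚ) / 2) / p = -((((q : ℚ) - (b 0 : ℚ) / 2) / p)) := by
      rw [hcen hc q hq]; ring
    rw [hδ, binomSeries_neg_base, map_mul, zpow_one]
    have hexp : classExp b p x - netExp b q = (∑ s ∈ D.erase q, netExp b s) + 1 := by rw [hsumD]; linarith
    rw [hexp, zpow_add₀ hm1, zpow_one, map_mul]
    ring
  · have hc1 : ¬ (¬ (2 : ℤ) ∣ b 0 ∧ CentreIn b p q) := fun h => hc ⟨h.1, hcq.1 h.2⟩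
    have hc2 : ¬ (¬ (2 : ℤ) ∣ b 0 ∧ CentreIn b p (τ q)) := fun h => hc ⟨h.1, hcτ.1 h.2⟩
    rw [if_neg hc1, if_neg hc2]
    rw [if_neg hc1] at hnear
    have hexp : classExp b p x - netExp b q = ∑ s ∈ D.erase q, netExp b s := by rw [hsumD]; linarith
    rw [hexp, mul_one, map_mul, map_one, mul_one]

include hD hinv he hlin hcen in
/-- **`ρ_{τq,σ} = (−1)^{E_x+σ} ρ_{q,σ}`** for a pole `q` and `σ ≤ n_q`. -/
theorem classRho_invol {q : ℕ} (hq : q ∈ (classSet b p x).filter (fun s => netExp b s ≠ 0)) (hqn : q ≤ (b 0).toNat)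
    {σ : ℕ} (hσ : (σ : ℤ) ≤ -netExp b q) :
    classRho b p (τ q) σ = (-1 : ℚ) ^ (classExp b p x + σ) * classRho b p q σ := by
  have hm1 : (-1 : ℚ) ≠ 0 := by norm_num
  unfold classRho
  rw [he q hq, classCofactor_invol b τ hD hinv he hlin hcen hq hqn, coeff_C_mul, coeff_rescale, ← mul_assoc,
    ← zpow_natCast, ← zpow_add₀ hm1]
  congr 1
  have hκ : (((-netExp b q).toNat - σ : ℕ) : ℤ) = -netExp b q - σ := by omega
  rw [hκ, show classExp b p x - netExp b q + (-netExp b q - σ) = (classExp b p x + σ) + 2 * (-netExp b q - σ) by ring,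
    neg_one_zpow_add_two_mul]

include hD hinv he hlin hcen in
/-- **`ŵ_x = 0`** when `3 + E_x` is odd and the class admits such an involution. -/
theorem wHat_eq_zero_of_invol (hodd : Odd (3 + classExp b p x)) : wHat b p x = 0 := by
  set D := (classSet b p x).filter (fun s => netExp b s ≠ 0) with hDdef
  set P3 := (classSet b p x).filter (fun s => netExp b s ≤ -3) with hP3
  have hw : wHat b p x = ∑ q ∈ P3, classRho b p q 3 := by
    unfold wHat classPoles
    rw [sum_ite, sum_const_zero, add_zero, filter_filter]
    refine sum_congr ?_ fun _ _ => rfl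
    rw [hP3]
    exact filter_congr fun s _ => ⟨fun h => h.2, fun h => ⟨by omega, h⟩⟩
  have hP3D : ∀ s ∈ P3, s ∈ D := fun s hs => by
    obtain ⟨hs1, hs2⟩ := mem_filter.1 hs
    exact mem_filter.2 ⟨hs1, by omega⟩
  have hτP3 : ∀ s ∈ P3, τ s ∈ P3 := fun s hs => by
    have hsD := hP3D s hs
    refine mem_filter.2 ⟨(mem_filter.1 (hD s hsD)).1, ?_⟩
    rw [he s hsD]; exact (mem_filter.1 hs).2
  have hflip : ∑ q ∈ P3, classRho b p q 3 = ∑ q ∈ P3, classRho b p (τ q) 3 :=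
    (sum_nbij' τ τ hτP3 hτP3 (fun s hs => hinv s (hP3D s hs)) (fun s hs => hinv s (hP3D s hs)) (fun _ _ => rfl)).symm
  have hneg : ∑ q ∈ P3, classRho b p (τ q) 3 = -∑ q ∈ P3, classRho b p q 3 := by
    rw [← sum_neg_distrib]
    refine sum_congr rfl fun q hq => ?_
    have hqD := hP3D q hq
    have hqn : q ≤ (b 0).toNat := le_of_mem_classSet b (mem_filter.1 hq).1
    rw [classRho_invol b τ hD hinv he hlin hcen hqD hqn (by have := (mem_filter.1 hq).2; push_cast; omega),
      show classExp b p x + ((3 : ℕ) : ℤ) = 3 + classExp b p x by push_cast; ring, hodd.neg_one_zpow]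
    ring
  rw [hw]
  linarith

end Invol

/-! ### The two involutions -/

/-- **Self-conjugate classes**: if the centre lies in the class of `x` and `3 + E_x` is odd, then `ŵ_x = 0`
(the conjugation `s ↦ b₀ − s` is a level-reversing involution of the class). -/
theorem wHat_eq_zero_of_centreIn (b : ℕ → ℤ) (h0 : 0 ≤ b 0) {p x : ℕ} (hcx : CentreIn b p x)
    (hodd : Odd (3 + classExp b p x)) : wHat b p x = 0 := by
  set n := (b 0).toNat with hn
  have hb0 : ((n : ℕ) : ℤ) = b 0 := Int.toNat_of_nonneg h0
  have hb0Q : ((n : ℕ) : ℚ) = ((b 0 : ℤ) : ℚ) := by exact_mod_cast hb0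
  -- the conjugation preserves the class
  have hC : ∀ s ∈ classSet b p x, n - s ∈ classSet b p x := by
    intro s hs
    obtain ⟨hsn, hres⟩ := mem_filter.1 hs
    rw [mem_range] at hsn
    refine mem_filter.2 ⟨mem_range.2 (by omega), ?_⟩
    -- `n − s ≡ x (mod p)` from `s ≡ x` and `p ∣ 2x − b₀`
    have h1 : (p : ℤ) ∣ (x : ℤ) - ((n - s : ℕ) : ℤ) := by
      obtain ⟨k, hk⟩ := hcx
      have h2 : (p : ℤ) ∣ (s : ℤ) - x := by
        rw [dvd_sub_comm]; exact Nat.modEq_iff_dvd.1 hres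
      obtain ⟨k2, hk2⟩ := h2
      refine ⟨k + k2, ?_⟩
      push_cast [Nat.cast_sub (show s ≤ n by omega)]
      rw [← hb0] at hk
      linear_combination hk + hk2
    exact Nat.modEq_iff_dvd.2 h1
  set D := (classSet b p x).filter (fun s => netExp b s ≠ 0) with hDdef
  have hDn : ∀ s ∈ D, s ≤ n := fun s hs => le_of_mem_classSet b (mem_filter.1 hs).1
  refine wHat_eq_zero_of_invol b (fun s => n - s) (fun s hs => ?_) (fun s hs => ?_) (fun s hs => ?_)
    (fun s hs t ht => ?_) (fun _ s hs => ?_) hodd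
  · obtain ⟨hsC, hse⟩ := mem_filter.1 hs
    exact mem_filter.2 ⟨hC s hsC, by rwa [netExp_reflect b h0 (hDn s hs)]⟩
  · have := hDn s hs
    show n - (n - s) = s
    omega
  · exact netExp_reflect b h0 (hDn s hs)
  · have h1 := hDn s hs; have h2 := hDn t ht
    push_cast [Nat.cast_sub h1, Nat.cast_sub h2]; ring
  · have h1 := hDn s hs
    push_cast [Nat.cast_sub h1]
    rw [hb0Q]; ring

/-- **Palindromic classes**: if the configuration of the class of `x` is palindromic and `3 + E_x` is odd, then `ŵ_x = 0`. -/
theorem wHat_eq_zero_of_palindromic (b : ℕ → ℤ) (h0 : 0 ≤ b 0) {p x : ℕ}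
    (hpal : IsPalindromic (classConfig b p x)) (hodd : Odd (3 + classExp b p x)) : wHat b p x = 0 := by
  by_cases hcx : CentreIn b p x
  · exact wHat_eq_zero_of_centreIn b h0 hcx hodd
  -- no centre entry: the configuration is the image of the non-neutral points
  set D := (classSet b p x).filter (fun s => netExp b s ≠ 0) with hDdef
  have hconf : classConfig b p x = D.image fun s => ((((2 * s : ℕ)) : ℤ), netExp b s) := by
    unfold classConfig; rw [if_neg (fun h => hcx h.2), union_empty]
  obtain ⟨m, -, hm⟩ := hpal
  rw [hconf] at hm
  -- the partner of a non-neutral point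
  have hpart : ∀ s ∈ D, ∃ s' ∈ D, (2 * (s' : ℤ)) = m - 2 * s ∧ netExp b s' = netExp b s := by
    intro s hs
    have h1 := hm _ (mem_image_of_mem _ hs)
    obtain ⟨s', hs', he⟩ := mem_image.1 h1
    simp only [Prod.mk.injEq] at he
    refine ⟨s', hs', ?_, he.2⟩
    have := he.1; push_cast at this ⊢; linarith
  set τ : ℕ → ℕ := fun s => ((m - 2 * (s : ℤ)) / 2).toNat with hτ
  have hτval : ∀ s ∈ D, ∀ s' ∈ D, (2 * (s' : ℤ)) = m - 2 * s → τ s = s' := by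
    intro s _ s' _ h
    simp only [hτ]
    rw [← h, Int.mul_ediv_cancel_left _ (by norm_num : (2 : ℤ) ≠ 0), Int.toNat_natCast]
  have hτD : ∀ s ∈ D, τ s ∈ D ∧ netExp b (τ s) = netExp b s ∧ (2 * ((τ s : ℕ) : ℤ)) = m - 2 * s := by
    intro s hs
    obtain ⟨s', hs', h2, he⟩ := hpart s hs
    rw [hτval s hs s' hs' h2]
    exact ⟨hs', he, h2⟩
  refine wHat_eq_zero_of_invol b τ (fun s hs => (hτD s hs).1) (fun s hs => ?_) (fun s hs => (hτD s hs).2.1)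
    (fun s hs t ht => ?_) (fun h => absurd h.2 hcx) hodd
  · obtain ⟨hs', -, h2⟩ := hτD s hs
    exact hτval _ hs' s hs (by linarith)
  · have h1 := (hτD s hs).2.2
    have h2 := (hτD t ht).2.2
    have h1' : (2 : ℚ) * (τ s : ℚ) = (m : ℚ) - 2 * s := by exact_mod_cast h1
    have h2' : (2 : ℚ) * (τ t : ℚ) = (m : ℚ) - 2 * t := by exact_mod_cast h2
    linarith

end Summit.KontsevichZagierPeriods.Zeta5Search.ClusterValuation

end
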